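import Summits.Ventures.QEC.Census.BB.BB144.OrbitBZ
import Summits.Ventures.QEC.Census.CertCheckBZ
import Summits.Ventures.QEC.Census.Bits
import HarnessLib

/-!
# C5 with automorphisms: the `bz_aut` label-cover check over words and its soundness
# (qec PARTITION v2.5 item 12.BZT; BZ-CHECKER-SPEC §C5 / CERT-FORMAT v1.1 §5.5, L6)

Companion of `OrbitBZ.lean` (flat translations as `Nat` arithmetic, `permWord`, the label action as popcount
parities) and of type-10's `Census/CertCheckBZ.lean` (method `bz`: blocks, `coverMask`, `coverOK` = C5 WITHOUT
automorphisms).  For method `bz_aut` on a bivariate-bicycle code the certificate lists the automorphisms as GROUP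
ELEMENTS `t = (t₁, t₂) ∈ ℤ_ℓ × ℤ_m` (no permutations, no row images: `BB.HXFlat_submatrix_translateFlat`,
type-07 `BZAutBBFlat.lean`), and C5 becomes: every non-zero label `λ` is covered by some block directly, or
`ρ_t · λ` is, where `ρ_t = Ld * (L.submatrix id (translateFlat t)⁻¹)ᵀ` is the label action (type-12
`AutomorphismLabelAction.lean`).  Here, entirely over `Nat` words (so `decide` / `native_decide` replay it):

* `labelWord n Ld v` — the label of the vector word `v` w.r.t. the dual rows `Ld` (bit `i` = `⟨Ld_i, v⟩`);
  `testBit_labelWord`, `ofBits_labelWord_apply`;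
* `probeWord ℓ m Ld L (t₁,t₂) λ` — the label word of the TRANSLATE (`permWord (translateIdx …)`) of the logical
  `⊕_{j ∈ λ} L[j]` (`xorSel`); `ofBits_probeWord`: it is the word of `ρ_t *ᵥ λ`;
* `coverAutOK ℓ m Ld L taus blocks : Bool` — every listed `t` is in range and every non-zero `λ < 2^k` has
  `coverMask` bit `λ` or bit `probeWord … t λ` for some listed `t`;
* `coverAutOK_sound`, `coverAutOK_hcover` — SOUNDNESS: exactly the `hcover` hypothesis of type-07's
  `BB.forall_lt_of_bzAut_translateFlat` / `BB.d_eq_of_bzAut_translateFlat_even` with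
  `A := {t : Mono ℓ m // (t₁,t₂) ∈ taus}`, `τ := Subtype.val`, given the checker's own reading of the cover mask
  (`hW : coverMask bit w ⇒ ∃ b, ofBits k w ∈ span (W b)`).

So a `[[144,12,12]]` `bz_aut` certificate replays as: type-10's structural + block checks (unchanged) with
`coverOK` replaced by `coverAutOK 12 6 LX LZ taus blocks`; the closer applies `BB.d_eq_of_bzAut_translateFlat_even`
with `hcover := coverAutOK_hcover …`.  HONEST FRAMING: no distance VALUE is asserted here.  Tier KERNEL,
axioms standard.
-/

namespace Summit.Ventures.QEC.Census

open Matrix Literature.InformationTheory.QuantumCodes Literature.InformationTheory.QuantumCodes.BB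

/-! ## C5 with automorphisms: the cover check `coverAutOK` and its soundness (method `bz_aut`) -/

section CoverAut

/-- The LABEL WORD of a vector word `v` with respect to the label rows `Ld` (the duals; side `Z`: `LX`):
bit `i` = parity of `popc n (Ld[i] &&& v)` = `⟨Ld_i, v⟩`. (definition, structural on `Ld`) -/
def labelWord (n : ℕ) : List ℕ → ℕ → ℕ
  | [], _ => 0
  | d :: ds, v => popc n (d &&& v) % 2 + 2 * labelWord n ds v

/-- Bit `i` of the label word is the parity `popc n (Ld[i] &&& v) % 2` (`Ld[i] := 0` past the end). -/
theorem testBit_labelWord (n : ℕ) : ∀ (Ld : List ℕ) (v i : ℕ),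
    (labelWord n Ld v).testBit i = decide (popc n (Ld.getD i 0 &&& v) % 2 = 1)
  | [], v, i => by simp [labelWord, popc_zero]
  | d :: ds, v, 0 => by
    rw [labelWord, Nat.testBit_zero, List.getD_cons_zero]
    have h := Nat.mod_lt (popc n (d &&& v)) (show 0 < 2 by decide)
    congr 1
    simp only [eq_iff_iff]
    omega
  | d :: ds, v, i + 1 => by
    rw [labelWord, Nat.testBit_succ, List.getD_cons_succ, ← testBit_labelWord n ds v i]
    have h := Nat.mod_lt (popc n (d &&& v)) (show 0 < 2 by decide)
    congr 1
    omega

/-- The label word read as a vector: coordinate `i` is `⟨Ld_i, v⟩` over `𝔽₂`. -/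
theorem ofBits_labelWord_apply (n : ℕ) (Ld : List ℕ) (v : ℕ) {k : ℕ} (i : Fin k) :
    ofBits k (labelWord n Ld v) i = ofBits n (Ld.getD i 0) ⬝ᵥ ofBits n v := by
  have key : ∀ p : ℕ, (if p % 2 = 1 then (1 : ZMod 2) else 0) = (p : ZMod 2) := by
    intro p
    rcases Nat.mod_two_eq_zero_or_one p with h | h
    · rw [if_neg (by omega), ← ZMod.natCast_mod, h, Nat.cast_zero]
    · rw [if_pos h, ← ZMod.natCast_mod, h, Nat.cast_one]
  rw [ofBits_dotProduct, ← key, show ofBits k (labelWord n Ld v) i =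
    if (labelWord n Ld v).testBit i then 1 else 0 from rfl, testBit_labelWord]
  simp only [decide_eq_true_eq]

/-- The PROBE WORD of a label word `w` under the translation `(t₁, t₂)`: the label of the translate of the
logical `⊕_{j ∈ w} L[j]` — i.e. the word of `ρ_t *ᵥ λ` (`probeWord_spec`). (definition) -/
def probeWord (ℓ m : ℕ) (Ld L : List ℕ) (t : ℕ × ℕ) (w : ℕ) : ℕ :=
  labelWord (ℓ * m + ℓ * m) Ld
    (permWord (BB.translateIdx ℓ m t.1 t.2) (xorSel L w) (ℓ * m + ℓ * m))

/-- **C5 for method `bz_aut` with translation automorphisms** (BZ-CHECKER-SPEC C5, group elements instead of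
permutations): every listed `t = (t₁, t₂)` has `t₁ < ℓ`, `t₂ < m`, and every non-zero label word `λ < 2^k`
(`k = |L|`) is covered by `coverMask blocks` (type-10, `Census/CertCheckBZ.lean`) directly or after
transport: bit `probeWord … t λ` of the cover mask is set for some listed `t`. (definition) -/
def coverAutOK (ℓ m : ℕ) (Ld L : List ℕ) (taus : List (ℕ × ℕ)) (blocks : List BZBlock) : Bool :=
  (taus.all fun t => decide (t.1 < ℓ) && decide (t.2 < m)) &&
    (List.range (2 ^ L.length)).all fun lam =>
      (lam == 0) || (coverMask blocks).testBit lam ||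
        taus.any fun t => (coverMask blocks).testBit (probeWord ℓ m Ld L t lam)

variable {ℓ m : ℕ} [NeZero ℓ] [NeZero m]

/-- The row matrix of the word list `L` is the matrix whose rows are `ofBits n L[j]`. -/
private theorem rowMatrix_eq_of_rows {n : ℕ} {L : List ℕ} {L' : Matrix (Fin L.length) (Fin n) (ZMod 2)}
    (hL : ∀ j, L' j = ofBits n (L.getD j 0)) : rowMatrix n L = L' := by
  funext j
  rw [hL j, List.getD_eq_getElem?_getD, List.getElem?_eq_getElem j.isLt, Option.getD_some]
  rfl

/-- **The probe word is `ρ_t *ᵥ λ`.** With `Ld' i = ofBits n Ld[i]`, `L' j = ofBits n L[j]` and `λ = ofBits k w`: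
`ofBits k (probeWord ℓ m Ld L (t₁,t₂) w) = (Ld' * (L'.submatrix id (translateFlat t)⁻¹)ᵀ) *ᵥ λ` — the label-action
matrix of type-07's `forall_lt_of_bzAut_translateFlat` applied to `λ`. -/
theorem ofBits_probeWord {Ld L : List ℕ} {Ld' L' : Matrix (Fin L.length) (Fin (ℓ * m + ℓ * m)) (ZMod 2)}
    (hLd : ∀ i, Ld' i = ofBits (ℓ * m + ℓ * m) (Ld.getD i 0))
    (hL : ∀ j, L' j = ofBits (ℓ * m + ℓ * m) (L.getD j 0)) (t : Mono ℓ m) (w : ℕ) :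
    ofBits L.length (probeWord ℓ m Ld L ((t.1 : ℕ), (t.2 : ℕ)) w) =
      (Ld' * (L'.submatrix id (BB.translateFlat t).symm)ᵀ) *ᵥ ofBits L.length w := by
  have hvec : ofBits L.length w ᵥ* L'.submatrix id (BB.translateFlat t).symm =
      (ofBits L.length w ᵥ* L') ∘ (BB.translateFlat t).symm := by
    have := submatrix_vecMul_equiv L' (ofBits L.length w) (Equiv.refl _) (BB.translateFlat t).symm
    simpa using this
  rw [← mulVec_mulVec, mulVec_transpose, hvec]
  funext i
  rw [probeWord, ofBits_labelWord_apply, ← hLd i, ← BB.ofBits_comp_translateFlat_symm, ofBits_xorSel_eq_vecMul,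
    rowMatrix_eq_of_rows hL]
  rfl

/-- **Soundness of `coverAutOK` (the `hcover` hypothesis of `forall_lt_of_bzAut_translateFlat`).** Let `P` be any
property of labels implied by a set bit of the cover mask (type-10: `P λ := ∃ b, λ ∈ span (W b)`). If
`coverAutOK ℓ m Ld L taus blocks` then every non-zero label `λ : Fin k → 𝔽₂` satisfies `P λ`, or
`P (ρ_t *ᵥ λ)` for some LISTED translation `t` (`ρ_t = Ld' * (L'.submatrix id (translateFlat t)⁻¹)ᵀ`). -/
theorem coverAutOK_sound {Ld L : List ℕ} {taus : List (ℕ × ℕ)} {blocks : List BZBlock}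
    (h : coverAutOK ℓ m Ld L taus blocks = true) {P : (Fin L.length → ZMod 2) → Prop}
    (hP : ∀ w : ℕ, (coverMask blocks).testBit w = true → P (ofBits L.length w))
    {Ld' L' : Matrix (Fin L.length) (Fin (ℓ * m + ℓ * m)) (ZMod 2)}
    (hLd : ∀ i, Ld' i = ofBits (ℓ * m + ℓ * m) (Ld.getD i 0))
    (hL : ∀ j, L' j = ofBits (ℓ * m + ℓ * m) (L.getD j 0))
    (lam : Fin L.length → ZMod 2) (hlam : lam ≠ 0) :
    P lam ∨ ∃ t : Mono ℓ m, ((t.1 : ℕ), (t.2 : ℕ)) ∈ taus ∧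
      P ((Ld' * (L'.submatrix id (BB.translateFlat t).symm)ᵀ) *ᵥ lam) := by
  -- the label as a word `w < 2^k`
  obtain ⟨w, hwlt, rfl⟩ : ∃ w, w < 2 ^ L.length ∧ ofBits L.length w = lam :=
    ⟨toBits lam, toBits_lt lam, ofBits_toBits lam⟩
  have hw0 : w ≠ 0 := by
    rintro rfl
    exact hlam (ofBits_zero _)
  simp only [coverAutOK, Bool.and_eq_true, List.all_eq_true, List.mem_range, Bool.or_eq_true, beq_iff_eq,
    List.any_eq_true, decide_eq_true_eq] at h
  obtain ⟨htaus, hall⟩ := h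
  rcases hall w hwlt with (h0 | hbit) | ⟨t, ht, hbit⟩
  · exact absurd h0 hw0
  · exact Or.inl (hP w hbit)
  · obtain ⟨h1, h2⟩ := htaus t ht
    refine Or.inr ⟨(⟨t.1, h1⟩, ⟨t.2, h2⟩), by simpa using ht, ?_⟩
    have key := ofBits_probeWord (ℓ := ℓ) (m := m) hLd hL (⟨t.1, h1⟩, ⟨t.2, h2⟩) w
    simp only at key
    rw [← key]
    exact hP _ hbit

/-- `coverAutOK` ⇒ **exactly the `hcover` hypothesis** of type-07's `BB.forall_lt_of_bzAut_translateFlat` /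
`BB.d_eq_of_bzAut_translateFlat_even` (`Census/BZAutBBFlat.lean`), with the automorphism index type
`A := {t : Mono ℓ m // (t₁, t₂) ∈ taus}` and `τ := Subtype.val`; `hW` is the checker's own reading of the cover
mask (a set bit `w` ⇒ `ofBits k w ∈ span (W b)` for some block `b`). -/
theorem coverAutOK_hcover {Ld L : List ℕ} {taus : List (ℕ × ℕ)} {blocks : List BZBlock}
    (h : coverAutOK ℓ m Ld L taus blocks = true) {nb jW : ℕ} {W : Fin nb → Fin jW → Fin L.length → ZMod 2}
    (hW : ∀ w : ℕ, (coverMask blocks).testBit w = true →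
      ∃ b, ofBits L.length w ∈ Submodule.span (ZMod 2) (Set.range (W b)))
    {Ld' L' : Matrix (Fin L.length) (Fin (ℓ * m + ℓ * m)) (ZMod 2)}
    (hLd : ∀ i, Ld' i = ofBits (ℓ * m + ℓ * m) (Ld.getD i 0))
    (hL : ∀ j, L' j = ofBits (ℓ * m + ℓ * m) (L.getD j 0)) :
    ∀ lam : Fin L.length → ZMod 2, lam ≠ 0 →
      (∃ b, lam ∈ Submodule.span (ZMod 2) (Set.range (W b))) ∨
        ∃ (a : {t : Mono ℓ m // ((t.1 : ℕ), (t.2 : ℕ)) ∈ taus}) (b : Fin nb),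
          (Ld' * (L'.submatrix id (BB.translateFlat a.1).symm)ᵀ) *ᵥ lam ∈
            Submodule.span (ZMod 2) (Set.range (W b)) := by
  intro lam hlam
  rcases coverAutOK_sound h (P := fun lam => ∃ b, lam ∈ Submodule.span (ZMod 2) (Set.range (W b))) hW hLd hL
      lam hlam with hP | ⟨t, ht, b, hb⟩
  · exact Or.inl hP
  · exact Or.inr ⟨⟨t, ht⟩, b, hb⟩


/-! ### Tabulated form: the columns of `ρ_t` once per translation (kernel-cheap cover replay; appended) -/

/-- The `k` columns of `ρ_t` as label words: column `j` = label of the translate of `L[j]`. Computing them ONCE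
per listed translation makes each cover probe a XOR of `≤ k` words of `k` bits (`xorSel`) instead of a
`2ℓm`-bit permutation + `k` popcounts. (definition) -/
def rhoCols (ℓ m : ℕ) (Ld L : List ℕ) (t : ℕ × ℕ) : List ℕ :=
  L.map fun lz => labelWord (ℓ * m + ℓ * m) Ld (permWord (BB.translateIdx ℓ m t.1 t.2) lz (ℓ * m + ℓ * m))

/-- **C5 with automorphisms, tabulated**: as `coverAutOK`, but probing `xorSel (rhoCols … t) λ` (the word of
`ρ_t *ᵥ λ` from the precomputed columns). Same verdicts as `coverAutOK`; cheap enough for `decide +kernel`.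
(definition) -/
def coverAutTabOK (ℓ m : ℕ) (Ld L : List ℕ) (taus : List (ℕ × ℕ)) (blocks : List BZBlock) : Bool :=
  (taus.all fun t => decide (t.1 < ℓ) && decide (t.2 < m)) &&
    (let cm := coverMask blocks
     let tabs := taus.map fun t => rhoCols ℓ m Ld L t
     (List.range (2 ^ L.length)).all fun lam =>
       (lam == 0) || cm.testBit lam || tabs.any fun cols => cm.testBit (xorSel cols lam))

/-- `permWord` of the zero word is zero. -/
theorem permWord_zero (f : ℕ → ℕ) : ∀ n, permWord f 0 n = 0
  | 0 => rfl
  | n + 1 => by rw [permWord, permWord_zero f n]; simp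

/-- The label of the zero word is zero. -/
theorem labelWord_zero (n : ℕ) : ∀ Ld : List ℕ, labelWord n Ld 0 = 0
  | [] => rfl
  | d :: ds => by rw [labelWord, labelWord_zero n ds, Nat.and_zero, popc_zero]

/-- A selected XOR of rows, read as a vector, is the sum of the selected rows (index-free form of
`ofBits_xorSel_eq_vecMul`). -/
theorem ofBits_xorSel_eq_sum_range (k : ℕ) : ∀ (G : List ℕ) (w : ℕ),
    ofBits k (xorSel G w) = ∑ j ∈ Finset.range G.length, if w.testBit j then ofBits k (G.getD j 0) else 0
  | [], w => by simp [xorSel, ofBits_zero]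
  | g :: gs, w => by
    rw [xorSel, ofBits_xor, ofBits_xorSel_eq_sum_range k gs (w / 2), List.length_cons, Finset.sum_range_succ',
      add_comm]
    congr 1
    · refine Finset.sum_congr rfl fun j _ => ?_
      rw [Nat.testBit_succ, List.getD_cons_succ]
    · rw [List.getD_cons_zero, Nat.testBit_zero]
      by_cases h : w % 2 = 1
      · simp [h]
      · simp [h, ofBits_zero]

/-- **The tabulated probe is `ρ_t *ᵥ λ`**: `ofBits k (xorSel (rhoCols … t) w) = ρ_t *ᵥ ofBits k w`. -/
theorem ofBits_xorSel_rhoCols {Ld L : List ℕ} {Ld' L' : Matrix (Fin L.length) (Fin (ℓ * m + ℓ * m)) (ZMod 2)}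
    (hLd : ∀ i, Ld' i = ofBits (ℓ * m + ℓ * m) (Ld.getD i 0))
    (hL : ∀ j, L' j = ofBits (ℓ * m + ℓ * m) (L.getD j 0)) (t : Mono ℓ m) (w : ℕ) :
    ofBits L.length (xorSel (rhoCols ℓ m Ld L ((t.1 : ℕ), (t.2 : ℕ))) w) =
      (Ld' * (L'.submatrix id (BB.translateFlat t).symm)ᵀ) *ᵥ ofBits L.length w := by
  have hlen : (rhoCols ℓ m Ld L ((t.1 : ℕ), (t.2 : ℕ))).length = L.length := List.length_map ..
  have hget : ∀ j : ℕ, (rhoCols ℓ m Ld L ((t.1 : ℕ), (t.2 : ℕ))).getD j 0 =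
      labelWord (ℓ * m + ℓ * m) Ld
        (permWord (BB.translateIdx ℓ m (t.1 : ℕ) (t.2 : ℕ)) (L.getD j 0) (ℓ * m + ℓ * m)) := by
    intro j
    have h0 : labelWord (ℓ * m + ℓ * m) Ld
        (permWord (BB.translateIdx ℓ m (t.1 : ℕ) (t.2 : ℕ)) 0 (ℓ * m + ℓ * m)) = 0 := by
      rw [permWord_zero, labelWord_zero]
    rw [rhoCols, ← h0, List.getD_map, h0]
  rw [ofBits_xorSel_eq_sum_range, hlen]
  funext i
  -- both sides are `∑_{j < k} [bit j of w] · ⟨Ld_i, L_j ∘ σ_t⁻¹⟩`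
  let F : ℕ → ZMod 2 := fun x =>
    if w.testBit x then Ld' i ⬝ᵥ (ofBits (ℓ * m + ℓ * m) (L.getD x 0) ∘ (BB.translateFlat t).symm) else 0
  have hR : ((Ld' * (L'.submatrix id (BB.translateFlat t).symm)ᵀ) *ᵥ ofBits L.length w) i =
      ∑ x ∈ Finset.range L.length, F x := by
    rw [← Fin.sum_univ_eq_sum_range]
    change ∑ j, (Ld' * (L'.submatrix id (BB.translateFlat t).symm)ᵀ) i j * ofBits L.length w j = _
    refine Finset.sum_congr rfl fun j _ => ?_
    rw [CSSCode.labelAction_apply, hL j]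
    change _ * (if w.testBit j then 1 else 0) = F j
    by_cases hb : w.testBit j = true
    · simp [F, hb]
    · simp [F, hb]
  have hLHS : (∑ j ∈ Finset.range L.length,
      if w.testBit j then ofBits L.length ((rhoCols ℓ m Ld L ((t.1 : ℕ), (t.2 : ℕ))).getD j 0) else 0) i =
      ∑ x ∈ Finset.range L.length, F x := by
    rw [Finset.sum_apply]
    refine Finset.sum_congr rfl fun x _ => ?_
    by_cases hb : w.testBit x = true
    · simp only [hb, if_true, F]
      rw [hget, ofBits_labelWord_apply, ← hLd i, ← BB.ofBits_comp_translateFlat_symm]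
    · simp [hb, F]
  rw [hLHS, hR]

/-- **Soundness of the tabulated check** (same conclusion as `coverAutOK_sound`). -/
theorem coverAutTabOK_sound {Ld L : List ℕ} {taus : List (ℕ × ℕ)} {blocks : List BZBlock}
    (h : coverAutTabOK ℓ m Ld L taus blocks = true) {P : (Fin L.length → ZMod 2) → Prop}
    (hP : ∀ w : ℕ, (coverMask blocks).testBit w = true → P (ofBits L.length w))
    {Ld' L' : Matrix (Fin L.length) (Fin (ℓ * m + ℓ * m)) (ZMod 2)}
    (hLd : ∀ i, Ld' i = ofBits (ℓ * m + ℓ * m) (Ld.getD i 0))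
    (hL : ∀ j, L' j = ofBits (ℓ * m + ℓ * m) (L.getD j 0))
    (lam : Fin L.length → ZMod 2) (hlam : lam ≠ 0) :
    P lam ∨ ∃ t : Mono ℓ m, ((t.1 : ℕ), (t.2 : ℕ)) ∈ taus ∧
      P ((Ld' * (L'.submatrix id (BB.translateFlat t).symm)ᵀ) *ᵥ lam) := by
  obtain ⟨w, hwlt, rfl⟩ : ∃ w, w < 2 ^ L.length ∧ ofBits L.length w = lam :=
    ⟨toBits lam, toBits_lt lam, ofBits_toBits lam⟩
  have hw0 : w ≠ 0 := by
    rintro rfl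
    exact hlam (ofBits_zero _)
  simp only [coverAutTabOK, Bool.and_eq_true, List.all_eq_true, List.mem_range, Bool.or_eq_true, beq_iff_eq,
    List.any_eq_true, decide_eq_true_eq, List.mem_map] at h
  obtain ⟨htaus, hall⟩ := h
  rcases hall w hwlt with (h0 | hbit) | ⟨cols, ⟨t, ht, rfl⟩, hbit⟩
  · exact absurd h0 hw0
  · exact Or.inl (hP w hbit)
  · obtain ⟨h1, h2⟩ := htaus t ht
    refine Or.inr ⟨(⟨t.1, h1⟩, ⟨t.2, h2⟩), by simpa using ht, ?_⟩
    have key := ofBits_xorSel_rhoCols (ℓ := ℓ) (m := m) hLd hL (⟨t.1, h1⟩, ⟨t.2, h2⟩) w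
    simp only at key
    rw [← key]
    exact hP _ hbit

/-- `coverAutTabOK` ⇒ the `hcover` hypothesis of `BB.forall_lt_of_bzAut_translateFlat` (as `coverAutOK_hcover`). -/
theorem coverAutTabOK_hcover {Ld L : List ℕ} {taus : List (ℕ × ℕ)} {blocks : List BZBlock}
    (h : coverAutTabOK ℓ m Ld L taus blocks = true) {nb jW : ℕ} {W : Fin nb → Fin jW → Fin L.length → ZMod 2}
    (hW : ∀ w : ℕ, (coverMask blocks).testBit w = true →
      ∃ b, ofBits L.length w ∈ Submodule.span (ZMod 2) (Set.range (W b)))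
    {Ld' L' : Matrix (Fin L.length) (Fin (ℓ * m + ℓ * m)) (ZMod 2)}
    (hLd : ∀ i, Ld' i = ofBits (ℓ * m + ℓ * m) (Ld.getD i 0))
    (hL : ∀ j, L' j = ofBits (ℓ * m + ℓ * m) (L.getD j 0)) :
    ∀ lam : Fin L.length → ZMod 2, lam ≠ 0 →
      (∃ b, lam ∈ Submodule.span (ZMod 2) (Set.range (W b))) ∨
        ∃ (a : {t : Mono ℓ m // ((t.1 : ℕ), (t.2 : ℕ)) ∈ taus}) (b : Fin nb),
          (Ld' * (L'.submatrix id (BB.translateFlat a.1).symm)ᵀ) *ᵥ lam ∈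
            Submodule.span (ZMod 2) (Set.range (W b)) := by
  intro lam hlam
  rcases coverAutTabOK_sound h (P := fun lam => ∃ b, lam ∈ Submodule.span (ZMod 2) (Set.range (W b))) hW hLd hL
      lam hlam with hP | ⟨t, ht, b, hb⟩
  · exact Or.inl hP
  · exact Or.inr ⟨⟨t, ht⟩, b, hb⟩

/-- Smoke test (kernel `decide` evaluates the tabulated replay): with no blocks nothing is covered. -/
example : coverAutTabOK 1 2 [3] [3] [(0, 1)] [] = false := by decide

/-- Smoke test: one block whose `W` spans the single label covers everything (no translation needed). -/
example : coverAutTabOK 1 2 [3] [3] [(0, 1)] [⟨[1], []⟩] = true := by decide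

end CoverAut

end Summit.Ventures.QEC.Census
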